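import Literature.Probability.LatticeModels.FieldScalingLimitPlusBoundaryProofs
import Literature.Probability.LatticeModels.ImprovedTreeDiagramBoundHolds
import HarnessLib

/-!
# crit-ising.S13, high-dimensional triviality of the Ising scaling limit: the discharge
# `highDim_triviality_holds`

Sibling proof file of `FieldScalingLimit.lean` (D-0014: theorems only, no definitions, no named
facts) for the named fact `Literature.Probability.LatticeModels.highDim_triviality` (for the
nearest-neighbour Ising model on `ℤᵈ`, `d ≥ 4`, every limit in law of the renormalised spin field
smeared under the finite-volume plus measures in the joint regime `δ L(δ) → ∞`, `0 ≤ β(δ) ≤ β_c`,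
with bounded non-degenerate two-point function, is a centred Gaussian field; Aizenman 1982 and
Fröhlich 1982 for `d ≥ 5`, Aizenman–Duminil-Copin, Ann. Math. 194 (2021), Thm. 1.2 for `d = 4`).

`FieldScalingLimitPlusBoundaryProofs.lean` reduced the fact to the single named fact
`aizenmanDuminilCopin_improvedTreeDiagramBound` (Aizenman–Duminil-Copin 2021, Thm. 1.3, the
`d = 4` improvement of the tree diagram bound; the §6.3 summation and the sliding-scale infrared
bound Thm. 5.6 being theorems of the tree), `highDim_triviality_of_improvedTreeDiagramBound`; that
fact has since been DISCHARGED (`aizenmanDuminilCopin_improvedTreeDiagramBound_holds`,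
`ImprovedTreeDiagramBoundHolds.lean`: Lemma 6.2 in finite volume and the mixing Theorem 6.4).
This file records the one-line assembly. Separate file because `FieldScalingLimit.lean` is
imported by the whole chain.

## References

* [AizenmanDuminilCopinAnnals2021] M. Aizenman, H. Duminil-Copin, *Marginal triviality of the
  scaling limits of critical 4D Ising and φ⁴₄ models*, Ann. of Math. 194 (2021), Thm. 1.2, Thm. 1.3.
* [Panis2023Triviality] R. Panis, *Triviality of the scaling limits of critical Ising and φ⁴
  models with effective dimension at least four* (2023), Cor. 1.8, Thm. 5.5.
* [AizenmanCMP1982] M. Aizenman, *Geometric analysis of φ⁴ fields and Ising models*, Comm. Math.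
  Phys. 86 (1982), Prop. 10.1 with (13.1).
-/

noncomputable section

namespace Literature.Probability.LatticeModels

/-- **crit-ising.S13 (high-dimensional triviality, `d ≥ 4`) — discharge of the named fact
`highDim_triviality`.** `highDim_triviality_of_improvedTreeDiagramBound` (the plus-box rendering
from Aizenman–Duminil-Copin's Thm. 1.3 alone; the case `d ≥ 5` unconditional,
`highDim_triviality_of_five_le`) applied to the discharged
`aizenmanDuminilCopin_improvedTreeDiagramBound_holds`.
[cite: AizenmanDuminilCopinAnnals2021, Thm. 1.2 (d = 4), Thm. 1.3 and §1.1 (d > 4)]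
[cite: Panis2023Triviality, Thm. 5.5] -/
theorem highDim_triviality_holds : highDim_triviality :=
  highDim_triviality_of_improvedTreeDiagramBound aizenmanDuminilCopin_improvedTreeDiagramBound_holds

end Literature.Probability.LatticeModels

end
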